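import Literature.Analysis.FluidPDE.CheskidovTotalDissipationProofs
import Literature.Analysis.FluidPDE.PassiveScalarWellPosednessProofs
import Literature.Analysis.FluidPDE.QuasiSelfSimilarFamilyProofs
import Literature.Analysis.FluidPDE.QuasiSelfSimilarCompatibleBlocksProofs
import HarnessLib

/-!
# Cheskidov's total-dissipation family from the Alberti–Crippa–Mazzucato blocks alone
(arXiv:2311.04182, §§3–4 from Thm. 3.1)

Topic `Literature/Analysis/FluidPDE`. Theorem-only assembly file for the vendored named fact
`Literature.Analysis.FluidPDE.cheskidov_total_dissipation_family` (`CheskidovTotalDissipation.lean`;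
Cheskidov 2023, §3 (3.2)–(3.13), §4 (4.2)–(4.13), §6 (6.2)–(6.5): the glued planar drifts, their
Navier–Stokes forces with a limit in `C(ℝ; L²)`, and the viscous scalars with total dissipation at
`t = 1`). Its printed proof has two inputs:

1. the quasi-self-similar mixing family (Cheskidov 2023, Thm. 3.1 = Bruè–De Lellis 2023,
   Thm. 4.1) — the named fact `Literature.Analysis.FluidPDE.alberti_crippa_mazzucato_family`
   (`QuasiSelfSimilarMixing.lean`, item (c) per level), NOT discharged, but proved in the tree
   from the structural fact `acm_building_blocks` (`QuasiSelfSimilarBuildingBlocks.lean`) by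
   `alberti_crippa_mazzucato_family_of_building_blocks` (`QuasiSelfSimilarFamilyProofs.lean`),
   itself proved from the kinematic leaf `acm_compatible_blocks`
   (`QuasiSelfSimilarCompatibleBlocks.lean`: the two generating moves of the Peano snake with
   their gate structure, ACM 2019, §8.1, §8.4) by `acm_building_blocks_of_compatible_blocks`
   (`QuasiSelfSimilarCompatibleBlocksProofs.lean`);
2. classical parabolic well-posedness of (4.2) on `T²` ("let `θ^m` be the unique smooth
   solution of (4.2)") — DISCHARGED, `Torus.exists_unique_isClassicalScalarTransportForcedOn_holds`
   (`PassiveScalarWellPosednessProofs.lean`).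

The §§3–4 construction from 1 and 2 is `cheskidov_total_dissipation_family_of_acm_family`
(`CheskidovTotalDissipationProofs.lean`). Composing: the fact follows from input 1 alone
(`cheskidov_total_dissipation_family_of_mixing_family`), from the structural fact
(`cheskidov_total_dissipation_family_of_acm_building_blocks`), and from the current kinematic leaf
(`cheskidov_total_dissipation_family_of_compatible_blocks`). What remains for
`cheskidov_total_dissipation_family_holds` is exactly `acm_compatible_blocks_holds` — the two
smooth time-dependent curves of ACM 2019, §8.1 (a)–(e), given in the source by Figures 7–9
(§8.9–8.11).

## References

* A. Cheskidov, *Dissipation anomaly and anomalous dissipation in incompressible fluid flows*,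
  arXiv:2311.04182 (2023), Thm. 3.1 (p. 10), §3 (3.2)–(3.13), §4 (4.2)–(4.13), §6 (6.2)–(6.5)
  (pp. 18–19).
* E. Bruè, C. De Lellis, *Anomalous dissipation for the forced 3D Navier–Stokes equations*,
  Comm. Math. Phys. 400 (2023), §4.1, Thm. 4.1.
* G. Alberti, G. Crippa, A. L. Mazzucato, *Exponential self-similar mixing by incompressible
  flows*, J. Amer. Math. Soc. 32 (2019), §6.2, §8.1, §8.4–8.8.
-/

noncomputable section

namespace Literature.Analysis.FluidPDE

/-- **Cheskidov's total-dissipation family from the mixing family alone.** The named fact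
`cheskidov_total_dissipation_family` (Cheskidov 2023, §§3–4, (6.2)–(6.5)) follows from the single
named fact `alberti_crippa_mazzucato_family` (Cheskidov 2023, Thm. 3.1 = Bruè–De Lellis 2023,
Thm. 4.1, item (c) per level): the other input of the printed proof, parabolic well-posedness of
(4.2), is the proved `Torus.exists_unique_isClassicalScalarTransportForcedOn_holds`, fed into
`cheskidov_total_dissipation_family_of_acm_family`. [cite: Cheskidov2023, Thm. 3.1, §4 (4.2)–(4.13) and §6 (6.2)–(6.5)] -/
theorem cheskidov_total_dissipation_family_of_mixing_family (h : alberti_crippa_mazzucato_family) :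
    cheskidov_total_dissipation_family :=
  cheskidov_total_dissipation_family_of_acm_family h
    Torus.exists_unique_isClassicalScalarTransportForcedOn_holds

/-- **Cheskidov's total-dissipation family from the structural building-block fact.** The fact
follows from `acm_building_blocks` (finitely many Alberti–Crippa–Mazzucato building blocks
patching smoothly with handover; ACM 2019, §8, as used in Bruè–De Lellis 2023, §4.1 and
Thm. 4.1) through the scaling analysis `alberti_crippa_mazzucato_family_of_building_blocks`
(`QuasiSelfSimilarFamilyProofs`). [cite: Cheskidov2023, Thm. 3.1 and §4] [cite: BrueDeLellisCMP2023, Thm. 4.1] -/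
theorem cheskidov_total_dissipation_family_of_acm_building_blocks (h : acm_building_blocks) :
    cheskidov_total_dissipation_family :=
  cheskidov_total_dissipation_family_of_mixing_family
    (alberti_crippa_mazzucato_family_of_building_blocks h)

/-- **Cheskidov's total-dissipation family from the kinematic leaf.** The fact follows from
`acm_compatible_blocks` (the compatible block system of the Peano snake: ACM 2019, §8.1 (a)–(e),
§8.4 (a)–(c), §8.6; Bruè–De Lellis 2023, §4.1 (i)–(iv)) through
`acm_building_blocks_of_compatible_blocks` (`QuasiSelfSimilarCompatibleBlocksProofs`: labels,
patching and gluing of ACM §6.2, §8.6–8.8). This is the whole remaining debt of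
`cheskidov_total_dissipation_family`. [cite: Cheskidov2023, Thm. 3.1 and §4] [cite: AlbertiCrippaMazzucato2019, §8.1, §8.4, §8.6] -/
theorem cheskidov_total_dissipation_family_of_compatible_blocks (h : acm_compatible_blocks) :
    cheskidov_total_dissipation_family :=
  cheskidov_total_dissipation_family_of_acm_building_blocks
    (acm_building_blocks_of_compatible_blocks h)

end Literature.Analysis.FluidPDE

end
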